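import Mathlib
import HarnessLib
import Literature.Probability.Percolation.CorrelationLengthDKTSupercritical
import Literature.Probability.Percolation.SharpnessDCTProofs

/-!
# Stub `stub_supercriticalRadiusMoment` of the crux `TruncatedSusceptibilityFiniteOfTheta`

Crux item stmt-CriticalPhenomena-0852
(`Summit.CriticalPhenomena.PercolationContinuityZ3.Theses.PercNecklaceBackbone.TruncatedSusceptibilityFiniteOfTheta`),
line `Lines/birth.lean`, STUB 1: the supercritical regime on the RADIUS law of finite clusters.
For `p > p_c(ℤ³)` the finite-cluster one-arm probabilities
`P_p(0 ↔ ∂B(n) inside B(n), |C(0)| < ∞) = P_p(siteToBoundary 3 n \ percolatesAt 0)` have a finite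
second shell moment, `Σ_n (n+1)² · P_p(siteToBoundary 3 n \ percolatesAt 0) < ∞`.

In print this is Grimmett 1999, Thm (8.21) (exponential decay `e^{-nσ(p)}`, `σ(p) > 0` for
`p > p_c`). In tree it follows from the discharged theorem
`DuminilcopinKozmaTassion2020_thm2_supercritical_holds` (for `p ∈ (p_c, 1)`:
`0 < exp(-C/(p-p_c)²) ≤ liminf_n -(1/n) log P_p[siteToBoundary 3 n ∩ (percolatesAt 0)ᶜ]`, hence an
eventual exponential bound and domination by `Σ (n+1)² e^{-cn}`), and from `DCT16.theta_one`
(`θ(1) = 1`, so at `p = 1` every term vanishes).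
-/

noncomputable section

namespace Summit.CriticalPhenomena.PercolationContinuityZ3.Theorems.TruncatedSusceptibilityFiniteOfTheta

open MeasureTheory Literature.Probability.Percolation Literature.Probability.LatticeModels

namespace StubSupercriticalRadiusMoment

/-- The dominating series: `Σ_n (n+1)² e^{-cn} < ∞` for `c > 0`
(expand `(n+1)² = n² + 2n + 1` and use `Real.summable_pow_mul_exp_neg_nat_mul`). -/
theorem summable_sq_mul_exp_neg {c : ℝ} (hc : 0 < c) :
    Summable fun n : ℕ => ((n : ℝ) + 1) ^ 2 * Real.exp (-c * n) := by
  have h2 := Real.summable_pow_mul_exp_neg_nat_mul 2 hc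
  have h1 := Real.summable_pow_mul_exp_neg_nat_mul 1 hc
  have h0 := Real.summable_pow_mul_exp_neg_nat_mul 0 hc
  have := (h2.add (h1.mul_left 2)).add h0
  refine this.congr fun n => ?_
  simp only [pow_zero, pow_one, one_mul]
  ring

/-- From a positive lower bound `a` on the liminf of the rate `-(1/n) log P_n` of a `[0,1]`-valued
sequence one gets the eventual exponential bound `P_n ≤ e^{-a n}`. -/
theorem eventually_le_exp_of_lt_liminf {P : ℕ → ℝ} (hP0 : ∀ n, 0 ≤ P n) (hP1 : ∀ n, P n ≤ 1)
    {a : ℝ} (ha : a < Filter.liminf (fun n : ℕ => -Real.log (P n) / (n : ℝ)) Filter.atTop) :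
    ∀ᶠ n : ℕ in Filter.atTop, P n ≤ Real.exp (-a * n) := by
  have hbdd : Filter.IsBoundedUnder (· ≥ ·) Filter.atTop
      (fun n : ℕ => -Real.log (P n) / (n : ℝ)) :=
    Filter.isBoundedUnder_of ⟨0, fun n =>
      div_nonneg (neg_nonneg.2 (Real.log_nonpos (hP0 n) (hP1 n))) (Nat.cast_nonneg n)⟩
  have hev := Filter.eventually_lt_of_lt_liminf ha hbdd
  filter_upwards [hev, Filter.eventually_gt_atTop 0] with n hn hn0
  have hn0' : (0 : ℝ) < n := Nat.cast_pos.2 hn0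
  have hlog : Real.log (P n) < -a * n := by
    rw [lt_div_iff₀ hn0'] at hn
    linarith
  rcases (hP0 n).eq_or_lt with h0 | hpos
  · rw [← h0]
    exact (Real.exp_pos _).le
  · exact ((Real.log_lt_iff_lt_exp hpos).1 hlog).le

/-- The case `p ∈ (p_c, 1)`: eventual exponential decay of `P_p(siteToBoundary 3 n \ percolatesAt 0)`
from `DuminilcopinKozmaTassion2020_thm2_supercritical_holds`. -/
theorem eventually_radius_le_exp (p : unitInterval)
    (hp : criticalProb (zdGraph 3) (0 : Site 3) < (p : ℝ)) (hp1 : (p : ℝ) < 1) :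
    ∃ c : ℝ, 0 < c ∧ ∀ᶠ n : ℕ in Filter.atTop,
      (bondPercolation (zdGraph 3) p).real (siteToBoundary 3 n \ percolatesAt 0) ≤
        Real.exp (-c * n) := by
  obtain ⟨C, _, hrate⟩ := DuminilcopinKozmaTassion2020_thm2_supercritical_holds 3 le_rfl
  have hlim := hrate p hp hp1
  set a : ℝ := Real.exp (-(C / ((p : ℝ) - criticalProb (zdGraph 3) (0 : Site 3)) ^ 2)) with ha
  have ha0 : 0 < a := Real.exp_pos _
  have ha2 := (half_lt_self ha0).trans_le hlim
  refine ⟨a / 2, half_pos ha0, ?_⟩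
  have hev := eventually_le_exp_of_lt_liminf
    (P := fun n : ℕ => (bondPercolation (zdGraph 3) p).real
      (siteToBoundary 3 n ∩ (percolatesAt (0 : Site 3))ᶜ))
    (fun _ => measureReal_nonneg) (fun _ => measureReal_le_one) ha2
  filter_upwards [hev] with n hn
  rw [Set.sdiff_eq]
  exact hn

/-- The case `p = 1`: `θ(1) = 1` (`DCT16.theta_one`), so the finite-cluster one-arm events are null. -/
theorem radius_one_eq_zero (n : ℕ) :
    (bondPercolation (zdGraph 3) 1).real (siteToBoundary 3 n \ percolatesAt 0) = 0 := by
  have hθ : (bondPercolation (zdGraph 3) 1).real (percolatesAt (0 : Site 3)) = 1 :=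
    DCT16.theta_one (d := 3) (by norm_num)
  have hmeas : MeasurableSet (percolatesAt (0 : Site 3) : Set (BondConfig (Site 3))) :=
    measurableSet_percolatesAt_holds (0 : Site 3)
  have hcompl : (bondPercolation (zdGraph 3) 1).real (percolatesAt (0 : Site 3))ᶜ = 0 := by
    rw [probReal_compl_eq_one_sub hmeas, hθ, sub_self]
  refine le_antisymm ?_ measureReal_nonneg
  calc (bondPercolation (zdGraph 3) 1).real (siteToBoundary 3 n \ percolatesAt 0)
      ≤ (bondPercolation (zdGraph 3) 1).real (percolatesAt (0 : Site 3))ᶜ :=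
        measureReal_mono (Set.sdiff_subset_compl _ _)
    _ = 0 := hcompl

end StubSupercriticalRadiusMoment

open StubSupercriticalRadiusMoment in
/-- **STUB 1 `supercriticalRadiusMoment`** of the crux `TruncatedSusceptibilityFiniteOfTheta`
(stmt-CriticalPhenomena-0852, line `birth`): for `p > p_c(ℤ³)`,
`Σ_n (n+1)² P_p(0 ↔ ∂B(n), |C(0)| < ∞) < ∞`. In print: Grimmett 1999 Thm (8.21). In tree: for
`p ∈ (p_c, 1)` the discharged `DuminilcopinKozmaTassion2020_thm2_supercritical_holds` (d = 3) gives an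
eventual bound `P_p(siteToBoundary 3 n \ percolatesAt 0) ≤ e^{-cn}` with `c > 0`, and the series is
dominated eventually by `Σ (n+1)² e^{-cn}`; for `p = 1`, `DCT16.theta_one` makes every term vanish. -/
theorem stub_supercriticalRadiusMoment :
    ∀ p : unitInterval, criticalProb (zdGraph 3) (0 : Site 3) < (p : ℝ) →
      Summable fun n : ℕ => ((n : ℝ) + 1) ^ 2 * (bondPercolation (zdGraph 3) p).real (siteToBoundary 3 n \ percolatesAt 0) := by
  intro p hp
  rcases p.2.2.lt_or_eq with hp1 | hp1
  · obtain ⟨c, hc, hev⟩ := eventually_radius_le_exp p hp hp1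
    refine (summable_sq_mul_exp_neg hc).of_norm_bounded_eventually_nat ?_
    filter_upwards [hev] with n hn
    rw [Real.norm_of_nonneg (mul_nonneg (by positivity) measureReal_nonneg)]
    exact mul_le_mul_of_nonneg_left hn (by positivity)
  · have hp1' : p = 1 := Subtype.ext hp1
    subst hp1'
    refine (summable_zero (α := ℝ) (β := ℕ)).congr fun n => ?_
    rw [radius_one_eq_zero n, mul_zero]

end Summit.CriticalPhenomena.PercolationContinuityZ3.Theorems.TruncatedSusceptibilityFiniteOfTheta

end
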